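import Summits.ABC.StewartYu.GenThreeInductionArchW
import HarnessLib

/-!
# Cell abc-stewartyu, WP-L.A shell (parcel P-A1): print's WLOG REDUCTIONS in the PIVOT-WEIGHTED currency —
# `DichotomyArchW` from «bound ∨ step» on reduced data (all `bⱼ ≠ 0`, `gcd b = 1`, weights sorted, pivot at a
# maximal weight, non-trivial regime)

`Summits/ABC/StewartYu/GenThreeReduceArchW.lean` — cell `abc-stewartyu` (HOME `run/shared/lean/pub/abc-stewartyu/`),
route `YuMatveevShapeRat` (rung A1.L, crux r2 `ArchCoreRat`, stmt-ABC-20502), seat p4 (g9), parcel WP-L.A P-A1; the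
pivot-weighted twin of `GenThreeReduceArch.lean` (lit WP-LA-SPEC §12 A3, §17).  Theorems only.

Reductions available to the frame for a datum `(a, b, A, B, k₀)` of `GenThreeInductionArchW.CoreArchW` under the
negated bound: (i) coordinates with `bⱼ = 0` (necessarily `j ≠ k₀`) are deleted — a `StepArchW` with `m₀ = 1`,
`D = 0`, the SAME `B` and the pivot carried along (FREE in this currency: `|bᵢ|Aᵢ ≤ B·A_{k₀}` restricts), needs
`0 ≤ C n`, `C r ≤ C n`; (ii) `b = d·b′` with `gcd b′ = 1`: `|b′ᵢ|Aᵢ ≤ |bᵢ|Aᵢ`, same `B`, same pivot, and the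
bound / the step for `b′` give those for `b` (`log|Λ(b′)| ≤ log|Λ(b)|`); (iii) relabelling by `Tuple.sort A`
(linear form, `Ω`, bound and step are invariant) and moving the pivot to a MAXIMAL weight (`|bᵢ|Aᵢ ≤ B·A_{k₀} ≤
B·A_{k₁}` when `A_{k₀} ≤ A_{k₁}`; `b_{k₁} ≠ 0` after (i)); (iv) the non-trivial regime (2.6)
`C(n)·Ω·log(eB) < ∑ Aⱼ|bⱼ| + log 2` (else Cor. 2.5).  `dichotomyArchW_of_reduced` packages (i)–(iv): the frame owes the STEP for reduced data under the negated
bound (2.14).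

Contents: `stepArchW_of_log_le`, `stepArchW_perm`, `stepArchW_of_exists_eq_zero`, `stepArchW_of_stepArchW_smul`,
`dichotomyArchW_of_reduced`.

WHAT THIS IS NOT: no analytic content; no crux moves.

References: Yu. V. Nesterenko, LNM 1819 (2003), §2 p. 56 (WLOG `bₖ ≠ 0`, `A₁ ≤ … ≤ Aₙ`), (2.6), Cor. 2.5,
Lemma 5.2 (p. 99: `b` primitive); E. M. Matveev, Izv. Math. 64 (2000), (1.3).
-/

noncomputable section

open Finset

namespace Summit.ABC.StewartYu.GenThreeReduceArchW

open Summit.ABC.StewartYu.GenThreeInductionArch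
open Summit.ABC.StewartYu.GenThreeInductionArchW
open Summit.ABC.StewartYu.GenThreeBaseArch (regime_of_not_le)
open Summit.ABC.StewartYu.GenThreeReduceArch (linearForm_perm prod_perm indep_perm comp_perm_ne_zero
  linearForm_smul log_abs_linearForm_le_of_smul exists_primitive)

variable {n : ℕ}

/-! ### Monotonicity and permutation invariance of the weighted step -/

/-- A weighted step for `(a, b′, A, B)` is one for `(a, b, A, B)` as soon as `log|Λ(b′)| ≤ log|Λ(b)|`.
[cite: Nesterenko2003, Prop 2.6 (2.10)] -/
theorem stepArchW_of_log_le {C : ℕ → ℝ} {a : Fin n → ℚ} {b b' : Fin n → ℤ} {A : Fin n → ℝ} {B : ℝ}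
    (h : StepArchW C n a b' A B)
    (hle : Real.log |∑ j, (b' j : ℝ) * Real.log (a j : ℝ)| ≤ Real.log |∑ j, (b j : ℝ) * Real.log (a j : ℝ)|) :
    StepArchW C n a b A B := by
  obtain ⟨r, θ, m, A', B', i₀, D, hr, hθ, hindθ, hA', hA1', hm, hB', hcmp, hcost⟩ := h
  exact ⟨r, θ, m, A', B', i₀, D, hr, hθ, hindθ, hA', hA1', hm, hB', hcmp.trans hle, hcost⟩

/-- **A weighted step for the relabelled datum is one for the datum.** [cite: Nesterenko2003, §2 p. 56] -/
theorem stepArchW_perm {C : ℕ → ℝ} (σ : Equiv.Perm (Fin n)) {a : Fin n → ℚ} {b : Fin n → ℤ} {A : Fin n → ℝ}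
    {B : ℝ} (h : StepArchW C n (fun j => a (σ j)) (fun j => b (σ j)) (fun j => A (σ j)) B) :
    StepArchW C n a b A B := by
  obtain ⟨r, θ, m, A', B', i₀, D, hr, hθ, hindθ, hA', hA1', hm, hB', hcmp, hcost⟩ := h
  rw [linearForm_perm σ a b] at hcmp
  rw [prod_perm σ A] at hcost
  exact ⟨r, θ, m, A', B', i₀, D, hr, hθ, hindθ, hA', hA1', hm, hB', hcmp, hcost⟩

/-- **A weighted step for `(a, b′, A, B)` is one for `(a, d·b′, A, B)`** (`d ≠ 0`). [cite: Nesterenko2003, Lemma 5.2] -/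
theorem stepArchW_of_stepArchW_smul {C : ℕ → ℝ} {a : Fin n → ℚ} {b' : Fin n → ℤ} {A : Fin n → ℝ} {B : ℝ}
    {d : ℤ} (hd : d ≠ 0) (h : StepArchW C n a b' A B) :
    StepArchW C n a (fun j => d * b' j) A B :=
  stepArchW_of_log_le h (log_abs_linearForm_le_of_smul a hd b')

/-! ### Deleting the zero coordinates, keeping the pivot -/

/-- **Print's first WLOG as a weighted step**: if some `bₖ = 0`, restricting to the support `s = {j : bⱼ ≠ 0} ∋ k₀`
(`r = |s| < n`, same `B`, weights `A|ₛ`, pivot `k₀`, `m₀ = 1`, `D = 0`) is a `StepArchW`, provided `0 ≤ C n`,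
`C r ≤ C n`. [cite: Nesterenko2003, §2 p. 56 (`bₖ ≠ 0` WLOG); Matveev2000, (1.3)] -/
theorem stepArchW_of_exists_eq_zero {C : ℕ → ℝ} (hC0 : 0 ≤ C n) (hCmono : ∀ r, r < n → C r ≤ C n)
    {a : Fin n → ℚ} {b : Fin n → ℤ} {A : Fin n → ℝ} {B : ℝ} {k₀ : Fin n}
    (ha : ∀ j, 0 < a j) (hind : ∀ μ : Fin n → ℤ, ∏ j, a j ^ μ j = 1 → μ = 0)
    (hA : ∀ j, Height.logHeight₁ (a j) ≤ A j) (hA1 : ∀ j, 1 ≤ A j) (hk₀ : b k₀ ≠ 0)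
    (hBw : ∀ j, (|b j| : ℝ) * A j ≤ B * A k₀) (hk : ∃ k, b k = 0) :
    StepArchW C n a b A B := by
  classical
  set s : Finset (Fin n) := Finset.univ.filter fun j => b j ≠ 0 with hs
  set r : ℕ := s.card with hrdef
  obtain ⟨k, hk⟩ := hk
  have hks : k ∉ s := by simp [hs, hk]
  have hk₀s : k₀ ∈ s := by simp [hs, hk₀]
  have hrn : r < n := by
    have h1 : s.card < (Finset.univ : Finset (Fin n)).card :=
      Finset.card_lt_card ⟨Finset.subset_univ _, fun h => hks (h (Finset.mem_univ k))⟩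
    simpa [hrdef] using h1
  set e : Fin r ≃ s := s.equivFin.symm with he
  set θ : Fin r → ℚ := fun i => a (e i) with hθdef
  set m : Fin r → ℤ := fun i => b (e i) with hmdef
  set A' : Fin r → ℝ := fun i => A (e i) with hA'def
  set i₀ : Fin r := e.symm ⟨k₀, hk₀s⟩ with hi₀def
  have hei₀ : ((e i₀ : s) : Fin n) = k₀ := by rw [hi₀def, Equiv.apply_symm_apply]
  have hreidx : ∀ (f : Fin n → ℚ), ∏ i, f (e i) = ∏ j ∈ s, f j := by
    intro f
    rw [Equiv.prod_comp e (fun x : s => f x), Finset.prod_coe_sort]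
  have hreidxR : ∀ (f : Fin n → ℝ), ∏ i, f (e i) = ∏ j ∈ s, f j := by
    intro f
    rw [Equiv.prod_comp e (fun x : s => f x), Finset.prod_coe_sort]
  have hrel : ∏ i, θ i ^ m i = (∏ j, a j ^ b j) ^ (1 : ℤ) := by
    rw [zpow_one]
    have h1 : ∏ i, θ i ^ m i = ∏ j ∈ s, a j ^ b j := by
      simpa [hθdef, hmdef] using hreidx (fun j => a j ^ b j)
    rw [h1]
    exact Finset.prod_filter_of_ne fun j _ hj => by
      intro hbj; apply hj; rw [hbj, zpow_zero]
  have hindθ : ∀ μ : Fin r → ℤ, ∏ i, θ i ^ μ i = 1 → μ = 0 := by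
    intro μ hμ
    set μ' : Fin n → ℤ := fun j => if h : j ∈ s then μ (e.symm ⟨j, h⟩) else 0 with hμ'
    have h1 : ∏ j, a j ^ μ' j = 1 := by
      have h2 : ∏ j, a j ^ μ' j = ∏ j ∈ s, a j ^ μ' j := by
        symm
        exact Finset.prod_filter_of_ne fun j _ hj => by
          by_contra hjs
          apply hj
          have : μ' j = 0 := by simp [hμ', hs] at hjs ⊢; intro h; exact absurd hjs h
          rw [this, zpow_zero]
      rw [h2, ← hreidx (fun j => a j ^ μ' j)]
      have h3 : ∀ i, a (e i) ^ μ' (e i) = θ i ^ μ i := by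
        intro i
        have hmem : ((e i : s) : Fin n) ∈ s := (e i).2
        have : μ' (e i) = μ i := by
          simp only [hμ', hmem, dite_true]
          congr 1
          have : (⟨((e i : s) : Fin n), hmem⟩ : s) = e i := Subtype.ext rfl
          rw [this, Equiv.symm_apply_apply]
        rw [this]
      rw [Finset.prod_congr rfl fun i _ => h3 i]
      exact hμ
    have h4 := hind μ' h1
    funext i
    have h5 := congrFun h4 (e i)
    have hmem : ((e i : s) : Fin n) ∈ s := (e i).2
    simp only [hμ', hmem, dite_true, Pi.zero_apply] at h5
    have : (⟨((e i : s) : Fin n), hmem⟩ : s) = e i := Subtype.ext rfl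
    rw [this, Equiv.symm_apply_apply] at h5
    exact h5
  have hprodle : ∏ i, A' i ≤ ∏ j, A j := by
    have h1 : ∏ i, A' i = ∏ j ∈ s, A j := by simpa [hA'def] using hreidxR A
    rw [h1, ← Finset.prod_filter_mul_prod_filter_not Finset.univ (fun j => b j ≠ 0) A]
    have h2 : 1 ≤ ∏ j ∈ Finset.univ.filter (fun j => ¬ b j ≠ 0), A j :=
      Finset.one_le_prod fun j _ => hA1 j
    have h3 : 0 ≤ ∏ j ∈ s, A j := Finset.prod_nonneg fun j _ => by linarith [hA1 j]
    calc ∏ j ∈ s, A j = (∏ j ∈ s, A j) * 1 := (mul_one _).symm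
      _ ≤ (∏ j ∈ s, A j) * ∏ j ∈ Finset.univ.filter (fun j => ¬ b j ≠ 0), A j :=
          mul_le_mul_of_nonneg_left h2 h3
  -- the pivot and the weighted clause carry over
  have hmi₀ : m i₀ ≠ 0 := by
    simp only [hmdef]; rw [hei₀]; exact hk₀
  have hBw' : ∀ i, (|m i| : ℝ) * A' i ≤ B * A' i₀ := by
    intro i
    simp only [hmdef, hA'def]; rw [hei₀]; exact hBw _
  have hB1 : 1 ≤ B := one_le_boundW hA1 hk₀ hBw
  have hlogB : 0 ≤ Real.log (Real.exp 1 * B) := zero_le_one.trans (one_le_log_exp_one_mul hB1)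
  have hcost : C r * (∏ i, A' i) * Real.log (Real.exp 1 * B) + Real.log |((1 : ℤ) : ℝ)| ≤
      C n * (∏ j, A j) * Real.log (Real.exp 1 * B) := by
    have h0 : Real.log |((1 : ℤ) : ℝ)| = 0 := by simp
    rw [h0, add_zero]
    have hA'0 : 0 ≤ ∏ i, A' i := Finset.prod_nonneg fun i _ => by
      have := hA1 (e i); simp only [hA'def]; linarith
    have h1 : C r * (∏ i, A' i) ≤ C n * (∏ j, A j) :=
      calc C r * (∏ i, A' i) ≤ C n * (∏ i, A' i) := mul_le_mul_of_nonneg_right (hCmono r hrn) hA'0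
        _ ≤ C n * (∏ j, A j) := mul_le_mul_of_nonneg_left hprodle hC0
    exact mul_le_mul_of_nonneg_right h1 hlogB
  exact stepArchW_of_pow_eq ha hrn θ m A' B i₀ (fun i => ha _) hindθ (fun i => hA _) (fun i => hA1 _)
    hmi₀ hBw' 1 one_ne_zero hrel hcost

/-! ### The weighted dichotomy from the dichotomy on reduced data -/

/-- **`DichotomyArchW C n` from the STEP on REDUCED data under the NEGATED bound**: the frame may assume every
`bⱼ ≠ 0`, `gcd b = 1`, the weights sorted (`Monotone A`), the pivot at a MAXIMAL weight (`∀ j, A j ≤ A k₀`), the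
negated bound `log|Λ| < −C(n)·Ω·log(eB)` (print's (2.14): the extrapolation's small value) and the regime
`C(n)·Ω·log(eB) < ∑ Aⱼ|bⱼ| + log 2` ((2.6), a consequence kept for convenience); requires `0 ≤ C n`,
`C r ≤ C n` for `r < n`.
[cite: Nesterenko2003, §2 p. 56, (2.6), Cor 2.5, Lemma 5.2; Matveev2000, (1.3)] -/
theorem dichotomyArchW_of_reduced {C : ℕ → ℝ} (hC0 : 0 ≤ C n) (hCmono : ∀ r, r < n → C r ≤ C n)
    (h : ∀ (a : Fin n → ℚ) (b : Fin n → ℤ) (A : Fin n → ℝ) (B : ℝ) (k₀ : Fin n),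
      (∀ j, 0 < a j) →
      (∀ μ : Fin n → ℤ, ∏ j, a j ^ μ j = 1 → μ = 0) →
      (∀ j, Height.logHeight₁ (a j) ≤ A j) → (∀ j, 1 ≤ A j) →
      (∀ j, b j ≠ 0) → Finset.univ.gcd b = 1 → Monotone A → (∀ j, A j ≤ A k₀) →
      (∀ j, (|b j| : ℝ) * A j ≤ B * A k₀) →
      ¬ -(C n * (∏ j, A j) * Real.log (Real.exp 1 * B)) ≤
          Real.log |∑ j, (b j : ℝ) * Real.log (a j : ℝ)| →
      C n * (∏ j, A j) * Real.log (Real.exp 1 * B) < ∑ j, A j * |(b j : ℝ)| + Real.log 2 →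
      StepArchW C n a b A B) :
    DichotomyArchW C n := by
  classical
  intro a b A B k₀ ha hind hA hA1 hk₀ hBw
  -- (i) zero coordinates first (the pivot is kept)
  by_cases hz : ∃ k, b k = 0
  · exact Or.inr (stepArchW_of_exists_eq_zero hC0 hCmono ha hind hA hA1 hk₀ hBw hz)
  push Not at hz
  -- (iii) sort the weights; new pivot := the last index (a maximal weight), all `bⱼ ≠ 0`
  set σ : Equiv.Perm (Fin n) := Tuple.sort A with hσ
  have hmono : Monotone (fun j => A (σ j)) := Tuple.monotone_sort A
  set a₁ : Fin n → ℚ := fun j => a (σ j) with ha₁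
  set b₁ : Fin n → ℤ := fun j => b (σ j) with hb₁
  set A₁ : Fin n → ℝ := fun j => A (σ j) with hA₁
  have hn : 0 < n := Fin.pos k₀
  set k₁ : Fin n := ⟨n - 1, by omega⟩ with hk₁
  have hk₁max : ∀ j, A₁ j ≤ A₁ k₁ := fun j => hmono (Fin.mk_le_mk.mpr (by have := j.2; omega))
  have ha' : ∀ j, 0 < a₁ j := fun j => ha _
  have hind' := indep_perm σ a hind
  have hA' : ∀ j, Height.logHeight₁ (a₁ j) ≤ A₁ j := fun j => hA _
  have hA1' : ∀ j, 1 ≤ A₁ j := fun j => hA1 _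
  have hbz' : ∀ j, b₁ j ≠ 0 := fun j => hz _
  -- the weighted clause at the new pivot: `|b(σ j)|A(σ j) ≤ B·A k₀ ≤ B·A₁ k₁`
  have hB1 : 1 ≤ B := one_le_boundW hA1 hk₀ hBw
  have hAk₀le : A k₀ ≤ A₁ k₁ := by
    have := hk₁max (σ.symm k₀)
    simpa only [hA₁, Equiv.apply_symm_apply] using this
  have hBw' : ∀ j, (|b₁ j| : ℝ) * A₁ j ≤ B * A₁ k₁ := fun j =>
    (hBw (σ j)).trans (mul_le_mul_of_nonneg_left hAk₀le (by linarith))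
  -- it suffices to settle the relabelled datum
  suffices hsuff : -(C n * (∏ j, A₁ j) * Real.log (Real.exp 1 * B)) ≤
        Real.log |∑ j, (b₁ j : ℝ) * Real.log (a₁ j : ℝ)| ∨ StepArchW C n a₁ b₁ A₁ B by
    rcases hsuff with hle | hstep
    · left
      rw [show ∏ j, A₁ j = ∏ j, A j from prod_perm σ A,
        show ∑ j, (b₁ j : ℝ) * Real.log (a₁ j : ℝ) = ∑ j, (b j : ℝ) * Real.log (a j : ℝ) from
          linearForm_perm σ a b] at hle
      exact hle
    · exact Or.inr (stepArchW_perm σ hstep)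
  -- (ii) gcd extraction
  have hb₁ne : b₁ ≠ 0 := fun h0 => hbz' k₁ (by rw [h0]; rfl)
  obtain ⟨d, b₂, hd, hb₂, hdb, hgcd, hle₂⟩ := exists_primitive hb₁ne
  have hb₂ne : ∀ j, b₂ j ≠ 0 := by
    intro j h0
    apply hbz' j
    rw [hdb j, h0, mul_zero]
  have hBw₂ : ∀ j, (|b₂ j| : ℝ) * A₁ j ≤ B * A₁ k₁ := fun j =>
    le_trans (mul_le_mul_of_nonneg_right (by exact_mod_cast hle₂ j) (by linarith [hA1' j])) (hBw' j)
  have hfun : b₁ = fun j => d * b₂ j := funext hdb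
  have hcmp : Real.log |∑ j, (b₂ j : ℝ) * Real.log (a₁ j : ℝ)| ≤
      Real.log |∑ j, (b₁ j : ℝ) * Real.log (a₁ j : ℝ)| := by
    rw [hfun]
    exact log_abs_linearForm_le_of_smul a₁ hd b₂
  -- (iv) the regime, for the primitive datum
  by_cases hbound : -(C n * (∏ j, A₁ j) * Real.log (Real.exp 1 * B)) ≤
      Real.log |∑ j, (b₂ j : ℝ) * Real.log (a₁ j : ℝ)|
  · exact Or.inl (hbound.trans hcmp)
  have hreg := regime_of_not_le a₁ ha' hind' A₁ hA' b₂ hb₂ hbound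
  have hstep := h a₁ b₂ A₁ B k₁ ha' hind' hA' hA1' hb₂ne hgcd hmono hk₁max hBw₂ hbound hreg
  right
  rw [hfun]
  exact stepArchW_of_stepArchW_smul hd hstep

end Summit.ABC.StewartYu.GenThreeReduceArchW

end
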